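import Summits.CriticalPhenomena.PercolationContinuityZ3.Theorems.PercNearOneGluingNoHeavyLowerTailCILStarTransfer
import Summits.CriticalPhenomena.PercolationContinuityZ3.Theorems.PercNearOneGluingNoHeavyLowerTailCILIsolatedObserver
import HarnessLib

/-!
# `NoHeavyLowerTail` (stmt-CriticalPhenomena-4575) — CIL for STEINER-CORRIDOR observers of any length

Lemma factory #5 (`prim-lf-5`, gen 14; memo `run/shared/lean/prim/prim-lf-5/STAR-RECURSION.md` §5).
`--supports stmt-CriticalPhenomena-4575`.  No definitions, no named facts, no sorries.

`μ = prodBernoulli w` on `Fin n`, relays `A`, level `j`, `N_x = |{z ∈ A : x ↔ z}|`; the cumulative isolation lemma CIL_j at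
an observer `x` is `∃ a ∈ A, μ(1 ≤ N_x ≤ j) ≤ μ(N_a ≤ j)` (registered `stub_cumulativeIsolation`, which closes the crux by
`Theorems.noHeavyLowerTail_of_stub_cumulativeIsolation`).

A **Steiner corridor** from `o` is a sequence of non-relay vertices `o = y₀, y₁, …, y_m` such that the only positive-weight
NON-relay pairs at `y_i` (other than loops) go to `y_{i+1}` (if `i < m`) and to `y_{i-1}` (if `0 < i`); the relays may be
attached to the corridor and to each other in any way (arbitrary weights).  For `m = 0` this is Kozma–Nitzan's isolated observer
(`cumulativeIsolation_of_isolatedObserver`, their Theorem 8 for the pocket-size property); `m = 1` with `y₁` attached only to relays is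
the closed-form case of their Theorem 5 (arXiv:2401.12397 §3.2).

* `cumulativeIsolation_of_steinerCorridor` — **CIL_j holds at the end `y₀ = o` of every Steiner corridor, for every `m` and `j`.**
  Proof: induction on `m` along the corridor.  Switching off the pairs at `y₀` (weights `w ∖ y₀`, the graph `G − y₀`) leaves a corridor
  `y₁, …, y_m` of length `m − 1`, so CIL_j holds at `y₁` in `G − y₀` by induction; `y₁` is the ONLY non-relay neighbour of `y₀`, so
  `cumulativeIsolation_of_oneLightSteinerNeighbour` (prover `prim-gen-induct`: star transfer + observer-set exchange + WITNESS UPGRADE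
  to the `(G − y₀)`-champion) carries CIL from `y₁` in `G − y₀` to `y₀` in `G` (`CutObserver.measureReal_preimage_avoid` moves the
  hypothesis between the two weightings).  The witness changes from level to level — the corridor is the simplest unbounded-DEPTH class,
  and it shows that depth alone is no obstruction to CIL; branching of the Steiner skeleton is (memo §5, Conjecture PU).
-/

noncomputable section

namespace Summit.CriticalPhenomena.PercolationContinuityZ3.Theorems

open MeasureTheory Set Literature.Probability.LatticeModels Literature.Probability.Percolation
open scoped Classical BigOperators

variable {n : ℕ}

open CutObserver in
/-- **CIL at the end of a Steiner corridor of any length.**  Let `y : ℕ → Fin n` and `m : ℕ` describe a corridor: `y i ∉ A`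
(`i ≤ m`), `y (i+1) ≠ y i` (`i < m`), and for `i ≤ m` every positive-weight pair `{y i, u}` with `u ∉ A`, `u ≠ y i` has
`u = y (i+1)` (and `i < m`) or `u = y (i-1)` (and `0 < i`).  Then `∃ a ∈ A, μ(1 ≤ N_{y 0} ≤ j) ≤ μ(N_a ≤ j)`.
[this work; cite: KozmaNitzan2024, Thm. 5 and Thm. 8 (§3.2 p. 13, §5.1 p. 32)] -/
theorem cumulativeIsolation_of_steinerCorridor (A : Finset (Fin n)) (j : ℕ) (hA : A.Nonempty) :
    ∀ (m : ℕ) (w : Sym2 (Fin n) → unitInterval) (y : ℕ → Fin n),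
      (∀ i, i ≤ m → y i ∉ A) →
      (∀ i, i < m → y (i + 1) ≠ y i) →
      (∀ i, i ≤ m → ∀ u : Fin n, u ∉ A → u ≠ y i → w s(y i, u) ≠ 0 →
        (i < m ∧ u = y (i + 1)) ∨ (0 < i ∧ u = y (i - 1))) →
      ∃ a ∈ A,
        (prodBernoulli w).real {ω : BondConfig (Fin n) |
            1 ≤ (A.filter fun x => ω ∈ openConn (y 0) x).card ∧
              (A.filter fun x => ω ∈ openConn (y 0) x).card ≤ j} ≤
          (prodBernoulli w).real {ω : BondConfig (Fin n) | (A.filter fun x => ω ∈ openConn a x).card ≤ j} := by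
  intro m
  induction m with
  | zero =>
    intro w y hyA _ hpath
    -- `y 0` has no positive-weight non-relay neighbour: Kozma–Nitzan's isolated observer
    refine cumulativeIsolation_of_isolatedObserver w A (y 0) j hA fun u huo huA => ?_
    by_contra hne
    rcases hpath 0 le_rfl u huA huo hne with ⟨h, -⟩ | ⟨h, -⟩
    · exact Nat.lt_irrefl 0 h
    · exact Nat.lt_irrefl 0 h
  | succ m ih =>
    intro w y hyA hdist hpath
    set o : Fin n := y 0 with ho
    set v : Fin n := y 1 with hv
    have hoA : o ∉ A := hyA 0 (Nat.zero_le _)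
    have hvo : v ≠ o := by simpa [ho, hv] using hdist 0 (Nat.succ_pos m)
    -- the weights with the pairs at `o` switched off, and the shifted corridor
    set w' : Sym2 (Fin n) → unitInterval := fun e => if e ∈ {e : Sym2 (Fin n) | o ∉ e} then w e else 0 with hw'
    set y' : ℕ → Fin n := fun i => y (i + 1) with hy'
    -- the shifted corridor satisfies the hypotheses for `w'`
    have hyA' : ∀ i, i ≤ m → y' i ∉ A := fun i hi => hyA (i + 1) (Nat.succ_le_succ hi)
    have hdist' : ∀ i, i < m → y' (i + 1) ≠ y' i := fun i hi => hdist (i + 1) (Nat.succ_lt_succ hi)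
    have hpath' : ∀ i, i ≤ m → ∀ u : Fin n, u ∉ A → u ≠ y' i → w' s(y' i, u) ≠ 0 →
        (i < m ∧ u = y' (i + 1)) ∨ (0 < i ∧ u = y' (i - 1)) := by
      intro i hi u huA hui hw
      -- `w' ≠ 0` forces `o ∉ s(y (i+1), u)` and `w ≠ 0`
      have hmem : s(y (i + 1), u) ∈ {e : Sym2 (Fin n) | o ∉ e} := by
        by_contra hnot
        apply hw
        simp only [hw', hy']
        rw [if_neg hnot]
      have hw0 : w s(y (i + 1), u) ≠ 0 := by
        intro h0; apply hw
        simp only [hw', hy']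
        rw [if_pos hmem, h0]
      have huo : u ≠ o := by
        intro h
        apply hmem
        rw [h]
        exact Sym2.mem_mk_right _ _
      rcases hpath (i + 1) (Nat.succ_le_succ hi) u huA hui hw0 with ⟨h1, h2⟩ | ⟨-, h2⟩
      · exact Or.inl ⟨Nat.lt_of_succ_lt_succ h1, by simpa [hy'] using h2⟩
      · rcases Nat.eq_zero_or_pos i with hi0 | hipos
        · subst hi0
          exact absurd (by simpa [ho] using h2) huo
        · refine Or.inr ⟨hipos, ?_⟩
          simp only [hy']
          have : i - 1 + 1 = i + 1 - 1 := by omega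
          rw [this]; exact h2
    -- induction: CIL at `v = y 1` in `G − o`
    obtain ⟨a, haA, hCIL'⟩ := ih w' y' hyA' hdist' hpath'
    -- move it to the `ω ∩ {e | o ∉ e}` events under `μ_w`
    have hy0 : y' 0 = v := by simp [hy', hv]
    have s1 : {ω : BondConfig (Fin n) |
          1 ≤ (A.filter fun z => (openGraph (ω ∩ {e | o ∉ e})).Reachable v z).card ∧
            (A.filter fun z => (openGraph (ω ∩ {e | o ∉ e})).Reachable v z).card ≤ j} =
        {ω : BondConfig (Fin n) | ω ∩ {e | o ∉ e} ∈ {ξ : BondConfig (Fin n) |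
          1 ≤ (A.filter fun x => ξ ∈ openConn (y' 0) x).card ∧
            (A.filter fun x => ξ ∈ openConn (y' 0) x).card ≤ j}} := by
      ext ω; simp only [mem_setOf_eq, filter_avoid_eq, hy0]
    have s2 : {ω : BondConfig (Fin n) |
          (A.filter fun z => (openGraph (ω ∩ {e | o ∉ e})).Reachable a z).card ≤ j} =
        {ω : BondConfig (Fin n) | ω ∩ {e | o ∉ e} ∈ {ξ : BondConfig (Fin n) |
          (A.filter fun x => ξ ∈ openConn a x).card ≤ j}} := by
      ext ω; simp only [mem_setOf_eq, filter_avoid_eq]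
    have e1 : (prodBernoulli w).real {ω : BondConfig (Fin n) |
          1 ≤ (A.filter fun z => (openGraph (ω ∩ {e | o ∉ e})).Reachable v z).card ∧
            (A.filter fun z => (openGraph (ω ∩ {e | o ∉ e})).Reachable v z).card ≤ j} =
        (prodBernoulli w').real {ω : BondConfig (Fin n) |
          1 ≤ (A.filter fun x => ω ∈ openConn (y' 0) x).card ∧
            (A.filter fun x => ω ∈ openConn (y' 0) x).card ≤ j} := by
      rw [s1, measureReal_preimage_avoid]
    have e2 : (prodBernoulli w).real {ω : BondConfig (Fin n) |
          (A.filter fun z => (openGraph (ω ∩ {e | o ∉ e})).Reachable a z).card ≤ j} =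
        (prodBernoulli w').real {ω : BondConfig (Fin n) | (A.filter fun x => ω ∈ openConn a x).card ≤ j} := by
      rw [s2, measureReal_preimage_avoid]
    have hCILv : ∃ a ∈ A,
        (prodBernoulli w).real {ω : BondConfig (Fin n) |
            1 ≤ (A.filter fun z => (openGraph (ω ∩ {e | o ∉ e})).Reachable v z).card ∧
              (A.filter fun z => (openGraph (ω ∩ {e | o ∉ e})).Reachable v z).card ≤ j} ≤
          (prodBernoulli w).real {ω : BondConfig (Fin n) |
            (A.filter fun z => (openGraph (ω ∩ {e | o ∉ e})).Reachable a z).card ≤ j} :=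
      ⟨a, haA, by rw [e1, e2]; exact hCIL'⟩
    -- `v` is the only non-relay neighbour of `o`: the one-light-Steiner-neighbour step (vacuous heaviness hypothesis)
    have hheavy : ∀ u, u ≠ o → u ≠ v → u ∉ A → w s(o, u) ≠ 0 → ∃ a ∈ A,
        (prodBernoulli w).real {ω : BondConfig (Fin n) |
            (A.filter fun z => (openGraph (ω ∩ {e | o ∉ e})).Reachable u z).card ≤ j} ≤
          (prodBernoulli w).real {ω : BondConfig (Fin n) |
            (A.filter fun z => (openGraph (ω ∩ {e | o ∉ e})).Reachable a z).card ≤ j} := by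
      intro u huo huv huA hwu
      exfalso
      rcases hpath 0 (Nat.zero_le _) u huA huo hwu with ⟨-, h2⟩ | ⟨h1, -⟩
      · exact huv (by simpa [hv] using h2)
      · exact Nat.lt_irrefl 0 h1
    exact cumulativeIsolation_of_oneLightSteinerNeighbour w A o v j hA hoA hheavy hCILv

/-- **Corridor CIL, list-free special case `m = 1` made explicit**: if `o ∉ A` has exactly one positive-weight non-relay
neighbour `v`, and `v`'s only positive-weight non-relay neighbour is `o`, then CIL_j holds at `o` (Kozma–Nitzan's Theorem-5
configuration "0 connected only to `A` and to `x`, `x` connected only to `A ∪ 0`", for the pocket-size property and arbitrary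
weights). [this work; cite: KozmaNitzan2024, Thm. 5 (p. 13)] -/
theorem cumulativeIsolation_of_privateSteinerNeighbour (w : Sym2 (Fin n) → unitInterval) (A : Finset (Fin n))
    (o v : Fin n) (j : ℕ) (hA : A.Nonempty) (hoA : o ∉ A) (hvA : v ∉ A) (hvo : v ≠ o)
    (ho : ∀ u : Fin n, u ∉ A → u ≠ o → u ≠ v → w s(o, u) = 0)
    (hv : ∀ u : Fin n, u ∉ A → u ≠ v → u ≠ o → w s(v, u) = 0) :
    ∃ a ∈ A,
      (prodBernoulli w).real {ω : BondConfig (Fin n) |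
          1 ≤ (A.filter fun x => ω ∈ openConn o x).card ∧ (A.filter fun x => ω ∈ openConn o x).card ≤ j} ≤
        (prodBernoulli w).real {ω : BondConfig (Fin n) | (A.filter fun x => ω ∈ openConn a x).card ≤ j} := by
  set y : ℕ → Fin n := fun i => if i = 0 then o else v with hy
  have h0 : y 0 = o := by simp [hy]
  have h1 : y 1 = v := by simp [hy]
  have key := cumulativeIsolation_of_steinerCorridor A j hA 1 w y
    (by
      intro i hi
      interval_cases i
      · simpa [h0] using hoA
      · simpa [h1] using hvA)
    (by
      intro i hi
      interval_cases i
      simpa [h0, h1] using hvo)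
    (by
      intro i hi u huA hui hwu
      interval_cases i
      · -- at `o`: the only non-relay neighbour is `v = y 1`
        left
        refine ⟨Nat.zero_lt_one, ?_⟩
        rw [h0] at hui hwu
        rw [h1]
        by_contra huv
        exact hwu (ho u huA hui huv)
      · -- at `v`: the only non-relay neighbour is `o = y 0`
        right
        refine ⟨Nat.zero_lt_one, ?_⟩
        rw [h1] at hui hwu
        simp only [Nat.sub_self, h0]
        by_contra huo
        exact hwu (hv u huA hui huo))
  simpa [h0] using key

/-- **CIL at an observer with ONE light corridor.**  Let `o ∉ A` have a non-relay neighbour `u = y 1` that starts a Steiner corridor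
`y 1, …, y m` in `G − o` (with `y 0 = o`; the corridor hypotheses of `cumulativeIsolation_of_steinerCorridor` for the indices `1 ≤ i ≤ m`,
where "earlier" vertices include `o`), and suppose every OTHER positive-weight non-relay neighbour `z` of `o` is heavy in `G − o`
(`μ(|π'(z)| ≤ j) ≤ μ(|π'(a)| ≤ j)` for some relay `a`, `π'` = relays joined off `o`).  Then CIL_j holds at `o`: the corridor theorem in
`G − o` feeds `cumulativeIsolation_of_oneLightSteinerNeighbour` (heavy neighbours are discharged by the observer-set exchange).
[this work; cite: KozmaNitzan2024, Thm. 5 (p. 13)] -/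
theorem cumulativeIsolation_of_lightCorridorNeighbour (w : Sym2 (Fin n) → unitInterval) (A : Finset (Fin n)) (j : ℕ)
    (hA : A.Nonempty) (m : ℕ) (y : ℕ → Fin n) (hm : 1 ≤ m)
    (hyA : ∀ i, i ≤ m → y i ∉ A)
    (hdist : ∀ i, i < m → y (i + 1) ≠ y i)
    (hpath : ∀ i, 1 ≤ i → i ≤ m → ∀ u : Fin n, u ∉ A → u ≠ y i → w s(y i, u) ≠ 0 →
      (i < m ∧ u = y (i + 1)) ∨ u = y (i - 1))
    (hheavy : ∀ z : Fin n, z ≠ y 0 → z ≠ y 1 → z ∉ A → w s(y 0, z) ≠ 0 → ∃ a ∈ A,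
      (prodBernoulli w).real {ω : BondConfig (Fin n) |
          (A.filter fun x => (openGraph (ω ∩ {e | y 0 ∉ e})).Reachable z x).card ≤ j} ≤
        (prodBernoulli w).real {ω : BondConfig (Fin n) |
          (A.filter fun x => (openGraph (ω ∩ {e | y 0 ∉ e})).Reachable a x).card ≤ j}) :
    ∃ a ∈ A,
      (prodBernoulli w).real {ω : BondConfig (Fin n) |
          1 ≤ (A.filter fun x => ω ∈ openConn (y 0) x).card ∧
            (A.filter fun x => ω ∈ openConn (y 0) x).card ≤ j} ≤
        (prodBernoulli w).real {ω : BondConfig (Fin n) | (A.filter fun x => ω ∈ openConn a x).card ≤ j} := by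
  set o : Fin n := y 0 with ho
  set v : Fin n := y 1 with hv
  have hoA : o ∉ A := hyA 0 (Nat.zero_le _)
  -- the corridor `y 1, …, y m` in the weights with the pairs at `o` switched off
  set w' : Sym2 (Fin n) → unitInterval := fun e => if e ∈ {e : Sym2 (Fin n) | o ∉ e} then w e else 0 with hw'
  set y' : ℕ → Fin n := fun i => y (i + 1) with hy'
  have hyA' : ∀ i, i ≤ m - 1 → y' i ∉ A := fun i hi => hyA (i + 1) (by omega)
  have hdist' : ∀ i, i < m - 1 → y' (i + 1) ≠ y' i := fun i hi => hdist (i + 1) (by omega)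
  have hpath' : ∀ i, i ≤ m - 1 → ∀ u : Fin n, u ∉ A → u ≠ y' i → w' s(y' i, u) ≠ 0 →
      (i < m - 1 ∧ u = y' (i + 1)) ∨ (0 < i ∧ u = y' (i - 1)) := by
    intro i hi u huA hui hw
    have hmem : s(y (i + 1), u) ∈ {e : Sym2 (Fin n) | o ∉ e} := by
      by_contra hnot
      apply hw
      simp only [hw', hy']
      rw [if_neg hnot]
    have hw0 : w s(y (i + 1), u) ≠ 0 := by
      intro h0; apply hw
      simp only [hw', hy']
      rw [if_pos hmem, h0]
    have huo : u ≠ o := by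
      intro h
      apply hmem
      rw [h]
      exact Sym2.mem_mk_right _ _
    rcases hpath (i + 1) (by omega) (by omega) u huA hui hw0 with ⟨h1, h2⟩ | h2
    · exact Or.inl ⟨by omega, by simpa [hy'] using h2⟩
    · rcases Nat.eq_zero_or_pos i with hi0 | hipos
      · subst hi0
        exact absurd (by simpa [ho] using h2) huo
      · refine Or.inr ⟨hipos, ?_⟩
        simp only [hy']
        have : i - 1 + 1 = i + 1 - 1 := by omega
        rw [this]; exact h2
  obtain ⟨a, haA, hCIL'⟩ := cumulativeIsolation_of_steinerCorridor A j hA (m - 1) w' y' hyA' hdist' hpath'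
  have hy0 : y' 0 = v := by simp [hy', hv]
  have s1 : {ω : BondConfig (Fin n) |
        1 ≤ (A.filter fun z => (openGraph (ω ∩ {e | o ∉ e})).Reachable v z).card ∧
          (A.filter fun z => (openGraph (ω ∩ {e | o ∉ e})).Reachable v z).card ≤ j} =
      {ω : BondConfig (Fin n) | ω ∩ {e | o ∉ e} ∈ {ξ : BondConfig (Fin n) |
        1 ≤ (A.filter fun x => ξ ∈ openConn (y' 0) x).card ∧
          (A.filter fun x => ξ ∈ openConn (y' 0) x).card ≤ j}} := by
    ext ω; simp only [mem_setOf_eq, CutObserver.filter_avoid_eq, hy0]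
  have s2 : {ω : BondConfig (Fin n) |
        (A.filter fun z => (openGraph (ω ∩ {e | o ∉ e})).Reachable a z).card ≤ j} =
      {ω : BondConfig (Fin n) | ω ∩ {e | o ∉ e} ∈ {ξ : BondConfig (Fin n) |
        (A.filter fun x => ξ ∈ openConn a x).card ≤ j}} := by
    ext ω; simp only [mem_setOf_eq, CutObserver.filter_avoid_eq]
  have hCILv : ∃ a ∈ A,
      (prodBernoulli w).real {ω : BondConfig (Fin n) |
          1 ≤ (A.filter fun z => (openGraph (ω ∩ {e | o ∉ e})).Reachable v z).card ∧
            (A.filter fun z => (openGraph (ω ∩ {e | o ∉ e})).Reachable v z).card ≤ j} ≤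
        (prodBernoulli w).real {ω : BondConfig (Fin n) |
          (A.filter fun z => (openGraph (ω ∩ {e | o ∉ e})).Reachable a z).card ≤ j} := by
    refine ⟨a, haA, ?_⟩
    rw [s1, s2, CutObserver.measureReal_preimage_avoid, CutObserver.measureReal_preimage_avoid]
    exact hCIL'
  exact cumulativeIsolation_of_oneLightSteinerNeighbour w A o v j hA hoA hheavy hCILv

end Summit.CriticalPhenomena.PercolationContinuityZ3.Theorems

end
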